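import Summits.BirchSwinnertonDyer.BirchSwinnertonDyer.Theorems.EisensteinPrimesResidualDevissageCount
import HarnessLib

/-!
# The residual dévissage COUNTED, SHARP form: the local error is `#(C^{G_{K_{∞,𝔭}}})^{p^c}` and the global error
# is `#C^{G_{K_∞}}` — so `#R(B) = #R(A) · #R(C)` exactly (modulo the residual surjectivity) when `C` has no
# `G_{K_{∞,𝔭}}`-fixed vector (cell `bsd-eis`, seat `bsd-line-x2-p2` gen 5, D-0154 KEY row 5; crux 4 `BSDpOnCellC`
# line b1; sequel of `…ResidualDevissageCount` / `…CountLower`)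

HONEST FRAMING (cell `bsd-eis`, run/shared/lean/pub/bsd-eis/): pure Galois-cohomology bookkeeping on constructed
objects (no definition, no named fact, no `sorry`, no `Theses` import); nothing about any curve is asserted;
nothing booked; no label or count moves; BSD and the main conjectures are proved for NO curve. Helper
`--supports stmt-BirchSwinnertonDyer-19034`; closes no registered stub.

`R(·) = R_𝔭^Σ(K_∞, ·) := GreenbergVatsal2000.datumStrictSelmer (ker κ) · p (AcSelmer.bdpData · p 𝔭) Σ`; `H = ker κ`;
`0 → A —j→ B —q→ C → 0` a `Γ_K`-equivariant exact sequence of discrete modules, `C` finite.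

* §1 `natCard_ker_resH1Hom_id_le_fixedPoints` — `#ker(j_* : H¹(G, A) → H¹(G, B)) ≤ #C^G` (the connecting map
  lands in the `G`-fixed points once `q ∘ j = 0` and `q` is equivariant; refines file 1 §1's `≤ #C`).
* §2 `natCard_datumStrictSelmer_le_of_devissage_fixed` — UPPER count with the local error at the fixed points:
  **`#R(B) ≤ #R(A) · #R(C) · #(C^{H ⊓ D_𝔭})^{p^c}`**; `…_of_noFixed`: if `C^{H ⊓ D_𝔭} = 0` (the NON-ANOMALOUS
  clause at `𝔭`: CGLS Prop. 17's `ψ|_{G_p} ≠ 1`; automatic at a NON-SPLIT multiplicative Eisenstein prime,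
  p626493 §1) then **`#R(B) ≤ #R(A) · #R(C)`** — no error term at all.
* §3 `natCard_mul_natCard_le_of_surjective_fixed` — LOWER count with the global error at the fixed points:
  given the surjectivity of `q_* : R(B) → R(C)`, **`#R(A) · #R(C) ≤ #R(B) · #C^{H}`**; `…_of_noFixed`: if
  `C^{H} = 0` (Keller–Yin's case `ψ|_{G_K} ≠ 1`) then `#R(A) · #R(C) ≤ #R(B)`.
* §4 the elliptic-curve forms along a `Γ_K`-stable `Φ ≤ E[p]`. Together: at a datum where `E[p]/Φ` has no
  `G_{K_{∞,𝔭}}`-fixed vector and `R(E[p]) → R(E[p]/Φ)` is onto,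
  `#R(Φ) · #R(E[p]/Φ) ≤ #R(E[p]) · #(E[p]/Φ)^{G_{K_∞}} ≤ #R(Φ) · #R(E[p]/Φ) · #(E[p]/Φ)^{G_{K_∞}}` — the residual
  form of Keller–Yin Thm. 1.4.1 / CGLS (eq:lambda-imp) `λ(𝔛^S_f) + ε = λ(𝔛^S_φ) + λ(𝔛^S_ψ)`, `ε ∈ {0, 1}` the
  dimension of `(E[p]/Φ)^{G_{K_∞}}`, with ONE input left (the residual surjectivity).

References: [KellerYin2024] Thm. 1.4.1 and proof, footnote to Lemma `SelfSelomega` (arXiv:2402.12781v2 §1.4);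
[CastellaGrossiLeeSkinner2022] Prop. 17 and (eq:lambda-imp) (arXiv:2008.02571 §1.4, §3.3); [GreenbergVatsal2000] §2
pp. 25–26; [SerreGaloisCohomology1997] I.§2.2, I.§5.4; cell p628626, p626493 (g4), p633072 (this seat).
-/

set_option autoImplicit false
set_option linter.dupNamespace false -- the summit namespace `…BirchSwinnertonDyer.BirchSwinnertonDyer.Theorems` (Sub = Summit, D-0017) trips it

noncomputable section

open scoped Classical

universe u

namespace Summit.BirchSwinnertonDyer.BirchSwinnertonDyer.Theorems.ResidualDevissageCountSharp

open Literature.NumberTheory.EllipticCurves Literature.NumberTheory.EllipticCurves.GreenbergSelmer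
  Literature.NumberTheory.EllipticCurves.GreenbergVatsal2000 Literature.NumberTheory.GaloisRepresentations
  Literature.NumberTheory.EllipticCurves.FineSelmerCoefficientMap
  NumberField IsDedekindDomain Field WeierstrassCurve
  Summit.BirchSwinnertonDyer.Rank1Residual.X11b Summit.BirchSwinnertonDyer.Rank1Residual.X11b.AcSelmer
  Summit.BirchSwinnertonDyer.Rank1Residual.X2.ResidualDevissageModules
  Summit.BirchSwinnertonDyer.BirchSwinnertonDyer.Theorems.UniversalToricDescentResidualSelmer
  Summit.BirchSwinnertonDyer.BirchSwinnertonDyer.Theorems.UniversalToricDescentResidualSelmerFinite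
  Summit.BirchSwinnertonDyer.BirchSwinnertonDyer.Theorems.CumulativeHeegnerInclusionAtThreeStubB1Devissage
  Summit.BirchSwinnertonDyer.BirchSwinnertonDyer.Theorems.CumulativeHeegnerInclusionAtThreeStubB1DevissageNamed
  Summit.BirchSwinnertonDyer.BirchSwinnertonDyer.Theorems.CumulativeHeegnerInclusionAtThreeResidualDevissage
  Summit.BirchSwinnertonDyer.BirchSwinnertonDyer.Theorems.ResidualDevissageFiniteKernel
  Summit.BirchSwinnertonDyer.BirchSwinnertonDyer.Theorems.ResidualDevissageCount

/-! ### §1 The kernel of `j_*` injects into the FIXED POINTS `C^G` -/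

section Kernel

variable {G : Type u} [Group G] [TopologicalSpace G] [IsTopologicalGroup G]
variable {A : Type u} [AddCommGroup A] [DistribMulAction G A] [TopologicalSpace A] [DiscreteTopology A]
variable {B : Type u} [AddCommGroup B] [DistribMulAction G B] [TopologicalSpace B] [DiscreteTopology B]
variable {C : Type u} [AddCommGroup C] [DistribMulAction G C]

/-- **`#ker(j_* : H¹(G, A) → H¹(G, B)) ≤ #C^G`** for a `G`-equivariant complex `A —j→ B —q→ C` with `j`
injective, `ker q ⊆ im j`, `q ∘ j = 0` and `C^G = {c | ∀ g, g • c = c}` finite: the connecting map `[φ] ↦ q b`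
(`j ∘ φ = ∂b`) is injective (file 1 §1) and `g • q b − q b = q (j (φ g)) = 0`.
[cite: SerreGaloisCohomology1997, I.§2.2 (Prop. 2) and I.§5.4] -/
theorem natCard_ker_resH1Hom_id_le_fixedPoints [Finite {c : C // ∀ g : G, g • c = c}] (j : A →+ B)
    (hj : ∀ (g : G) (a : A), j (ContinuousMonoidHom.id G g • a) = g • j a) (hinj : Function.Injective j)
    (q : B →+ C) (hq : ∀ (g : G) (b : B), q (g • b) = g • q b) (hqj : ∀ a : A, q (j a) = 0)
    (hexact : ∀ b : B, q b = 0 → ∃ a : A, j a = b) :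
    Nat.card {y : discreteH1 G A // resH1Hom (ContinuousMonoidHom.id G) j hj y = 0} ≤
      Nat.card {c : C // ∀ g : G, g • c = c} := by
  have hj' : ∀ (g : G) (a : A), j (g • a) = g • j a := hj
  have hrep : ∀ y : {y : discreteH1 G A // resH1Hom (ContinuousMonoidHom.id G) j hj y = 0},
      ∃ φ : contOneCocycles (discreteTopRep G A), ∃ b : B,
        oneCocycleClass _ φ = y.1 ∧ ∀ g : G, j (φ.1 g) = g • b - b := by
    intro y
    obtain ⟨φ, hφ⟩ := oneCocycleClass_surjective _ y.1
    have h0 := y.2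
    rw [← hφ, resH1Hom_id_oneCocycleClass, oneCocycleClass_eq_zero_iff] at h0
    obtain ⟨b, hb⟩ := h0
    exact ⟨φ, b, hφ, fun g ↦ hb g⟩
  choose φ b hφ hb using hrep
  have hfix : ∀ y, ∀ g : G, g • q (b y) = q (b y) := fun y g ↦ by
    rw [← hq, ← sub_eq_zero, ← map_sub, ← hb, hqj]
  have hf : Function.Injective fun y : {y : discreteH1 G A //
      resH1Hom (ContinuousMonoidHom.id G) j hj y = 0} ↦
      (⟨q (b y), hfix y⟩ : {c : C // ∀ g : G, g • c = c}) := by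
    intro y y' h
    have h' : q (b y) = q (b y') := by
      dsimp only at h
      exact Subtype.mk.inj h
    have hq0 : q (b y - b y') = 0 := by rw [map_sub, h', sub_self]
    obtain ⟨a₀, ha₀⟩ := hexact _ hq0
    apply Subtype.ext
    rw [← hφ y, ← hφ y', ← sub_eq_zero, ← oneCocycleClass_sub, oneCocycleClass_eq_zero_iff]
    refine ⟨a₀, fun g ↦ hinj ?_⟩
    change j (((φ y) - (φ y')).1 g) = j (g • a₀ - a₀)
    rw [Submodule.coe_sub, ContinuousMap.sub_apply, map_sub, hb, hb, map_sub, hj', ha₀, smul_sub]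
    abel
  exact Nat.card_le_card_of_injective _ hf

/-- If `C^G = 0` the kernel of `j_*` is trivial: `#ker j_* ≤ 1`. [cite: SerreGaloisCohomology1997, I.§2.2] -/
theorem natCard_ker_resH1Hom_id_le_one_of_noFixed (j : A →+ B)
    (hj : ∀ (g : G) (a : A), j (ContinuousMonoidHom.id G g • a) = g • j a) (hinj : Function.Injective j)
    (q : B →+ C) (hq : ∀ (g : G) (b : B), q (g • b) = g • q b) (hqj : ∀ a : A, q (j a) = 0)
    (hexact : ∀ b : B, q b = 0 → ∃ a : A, j a = b) (hS : ∀ c : C, (∀ g : G, g • c = c) → c = 0) :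
    Nat.card {y : discreteH1 G A // resH1Hom (ContinuousMonoidHom.id G) j hj y = 0} ≤ 1 := by
  haveI : Subsingleton {c : C // ∀ g : G, g • c = c} :=
    ⟨fun x y ↦ Subtype.ext ((hS x.1 x.2).trans (hS y.1 y.2).symm)⟩
  haveI : Finite {c : C // ∀ g : G, g • c = c} := Finite.of_subsingleton
  refine (natCard_ker_resH1Hom_id_le_fixedPoints j hj hinj q hq hqj hexact).trans ?_
  exact Finite.card_le_one_iff_subsingleton.mpr inferInstance

end Kernel

/-! ### §2 UPPER count with the local error at the fixed points of `H ⊓ D_𝔭` -/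

section Residual

variable {K : Type} [Field K] [NumberField K] {p : ℕ} [Fact p.Prime] (κ : ZpExtension K p)
  (𝔭 : HeightOneSpectrum (𝓞 K)) (S₀ : Set (HeightOneSpectrum (𝓞 K)))

variable {A : Type} [AddCommGroup A] [DistribMulAction (absoluteGaloisGroup K) A] [TopologicalSpace A]
  [DiscreteTopology A]
variable {B : Type} [AddCommGroup B] [DistribMulAction (absoluteGaloisGroup K) B] [TopologicalSpace B]
  [DiscreteTopology B]
variable {C : Type} [AddCommGroup C] [DistribMulAction (absoluteGaloisGroup K) C] [TopologicalSpace C]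
  [DiscreteTopology C]

/-- **Upper count, sharp local term: `#R(B) ≤ #R(A) · #R(C) · #(C^{H ⊓ D_𝔭})^{p^c}`** (hypotheses as in file 1
§3 plus `q ∘ j = 0`; `C^{H ⊓ D_𝔭}` = the vectors of `C` fixed by the decomposition group of `K_∞` at `𝔭`). Same
proof as file 1 §3 with §1 above at `G = H ⊓ D_𝔭` in place of `#T ≤ #C`.
[cite: CastellaGrossiLeeSkinner2022, Prop. 17 (arXiv:2008.02571 §1.4)] [cite: KellerYin2024, Thm. 1.4.1 (arXiv:2402.12781v2 §1.4)] -/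
theorem natCard_datumStrictSelmer_le_of_devissage_fixed [Finite C]
    (h𝔭 : ((p : ℕ) : 𝓞 K) ∈ 𝔭.asIdeal) (j : A →+ B)
    (hj' : ∀ (σ : absoluteGaloisGroup K) (a : A), j (σ • a) = σ • j a) (hinj : Function.Injective j)
    (q : B →+ C) (hq' : ∀ (σ : absoluteGaloisGroup K) (b : B), q (σ • b) = σ • q b)
    (hqj : ∀ a : A, q (j a) = 0)
    (hsurj : Function.Surjective q) (hexact : ∀ b : B, q b = 0 → ∃ a : A, j a = b)
    (hcontB : ∀ b : B, Continuous fun g : absoluteGaloisGroup K ↦ g • b)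
    (hU : ∀ v : HeightOneSpectrum (𝓞 K), v ∉ S₀ → ((p : ℕ) : 𝓞 K) ∉ v.asIdeal →
      Function.Injective
        (resH1Hom (ContinuousMonoidHom.id (inertiaIn κ.kerSubgroup v)) j (fun _ a ↦ hj' _ a)))
    (c : ℕ) (τ : ℕ → absoluteGaloisGroup K)
    (hreps : ∀ x : Literature.NumberTheory.EllipticCurves.subgroupH1 κ.kerSubgroup A,
      (∀ i, i < p ^ c → resOfLe A (inf_le_left : κ.kerSubgroup ⊓ decomp 𝔭 ≤ κ.kerSubgroup)
        (conjH1 κ.kerSubgroup A (τ i) x) = 0) →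
      ∀ σ : absoluteGaloisGroup K, resOfLe A (inf_le_left : κ.kerSubgroup ⊓ decomp 𝔭 ≤ κ.kerSubgroup)
        (conjH1 κ.kerSubgroup A σ x) = 0)
    (hA : (datumStrictSelmer κ.kerSubgroup A p (AcSelmer.bdpData A p 𝔭) S₀ :
      Set (Literature.NumberTheory.EllipticCurves.subgroupH1 κ.kerSubgroup A)).Finite)
    (hC : (datumStrictSelmer κ.kerSubgroup C p (AcSelmer.bdpData C p 𝔭) S₀ :
      Set (Literature.NumberTheory.EllipticCurves.subgroupH1 κ.kerSubgroup C)).Finite) :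
    Nat.card (datumStrictSelmer κ.kerSubgroup B p (AcSelmer.bdpData B p 𝔭) S₀) ≤
      Nat.card (datumStrictSelmer κ.kerSubgroup A p (AcSelmer.bdpData A p 𝔭) S₀) *
        Nat.card (datumStrictSelmer κ.kerSubgroup C p (AcSelmer.bdpData C p 𝔭) S₀) *
          Nat.card {x : C // ∀ g : ↥(κ.kerSubgroup ⊓ decomp 𝔭), g • x = x} ^ (p ^ c) := by
  let H := κ.kerSubgroup
  let jH := resH1Hom (ContinuousMonoidHom.id H) j (fun _ a ↦ hj' _ a)
  let qH := resH1Hom (ContinuousMonoidHom.id H) q (fun _ b ↦ hq' _ b)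
  let jD := resH1Hom (ContinuousMonoidHom.id ↥(H ⊓ decomp 𝔭)) j (fun _ a ↦ hj' _ a)
  have hcontH : ∀ b : B, Continuous fun g : H ↦ g • b := fun b ↦
    (hcontB b).comp continuous_subtype_val
  -- the local kernel `T` is finite with `#T ≤ #C^{H ⊓ D_𝔭}`
  have hT : Set.Finite {y : Literature.NumberTheory.EllipticCurves.subgroupH1 (H ⊓ decomp 𝔭) A | jD y = 0} :=
    finite_ker_resH1Hom_id_of_finite (G := ↥(H ⊓ decomp 𝔭)) j (fun _ a ↦ hj' _ a) hinj q hexact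
  have hTle : Nat.card {y : Literature.NumberTheory.EllipticCurves.subgroupH1 (H ⊓ decomp 𝔭) A // jD y = 0} ≤
      Nat.card {x : C // ∀ g : ↥(H ⊓ decomp 𝔭), g • x = x} :=
    natCard_ker_resH1Hom_id_le_fixedPoints (G := ↥(H ⊓ decomp 𝔭)) j (fun _ a ↦ hj' _ a) hinj q
      (fun _ b ↦ hq' _ b) hqj hexact
  -- file 1 §2
  obtain ⟨hYfin, hYle⟩ := natCard_comap_datumStrictSelmer_le κ 𝔭 S₀ h𝔭 j hj' hU c τ hreps hT hA
  let Y : AddSubgroup (Literature.NumberTheory.EllipticCurves.subgroupH1 H A) :=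
    (datumStrictSelmer H B p (AcSelmer.bdpData B p 𝔭) S₀).comap jH
  haveI : Finite Y := hYfin
  -- count through `q_*|_{R(B)}`
  let RB := datumStrictSelmer H B p (AcSelmer.bdpData B p 𝔭) S₀
  let g' : RB →+ Literature.NumberTheory.EllipticCurves.subgroupH1 H C := qH.comp RB.subtype
  have hcard : Nat.card RB = Nat.card g'.ker * Nat.card g'.range :=
    ResidualDevissageCount.natCard_eq_card_ker_mul_card_range g'
  haveI hCfin : Finite (datumStrictSelmer H C p (AcSelmer.bdpData C p 𝔭) S₀) := hC.to_subtype
  have hrangeC : ∀ z ∈ g'.range, z ∈ datumStrictSelmer H C p (AcSelmer.bdpData C p 𝔭) S₀ := by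
    rintro _ ⟨r, rfl⟩
    exact resH1Hom_id_mem_residualSelmer H p 𝔭 S₀ q hq' (fun _ b ↦ hq' _ b) r.2
  have hrange_le : Nat.card g'.range ≤ Nat.card (datumStrictSelmer H C p (AcSelmer.bdpData C p 𝔭) S₀) :=
    Nat.card_le_card_of_injective (fun z ↦ (⟨(z : Literature.NumberTheory.EllipticCurves.subgroupH1 H C),
      hrangeC _ z.2⟩ : datumStrictSelmer H C p (AcSelmer.bdpData C p 𝔭) S₀))
      fun z z' h ↦ by
        dsimp only at h
        exact Subtype.ext (Subtype.mk.inj h)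
  have hkerY : ∀ r : g'.ker, ∃ x : Y, jH (x : Literature.NumberTheory.EllipticCurves.subgroupH1 H A) =
      ((r : RB) : Literature.NumberTheory.EllipticCurves.subgroupH1 H B) := by
    intro r
    have hr : qH ((r : RB) : Literature.NumberTheory.EllipticCurves.subgroupH1 H B) = 0 :=
      (AddMonoidHom.mem_ker).mp r.2
    obtain ⟨x, hx⟩ := exists_resH1Hom_eq_of_resH1Hom_eq_zero (G := H) j (fun _ a ↦ hj' _ a) hinj q
      (fun _ b ↦ hq' _ b) hsurj hexact hcontH hr
    have hxY : x ∈ Y := by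
      change jH x ∈ RB
      rw [hx]; exact (r : RB).2
    exact ⟨⟨x, hxY⟩, hx⟩
  choose xr hxr using hkerY
  have hker_le : Nat.card g'.ker ≤ Nat.card Y := by
    refine Nat.card_le_card_of_injective xr fun r r' h ↦ ?_
    apply Subtype.ext; apply Subtype.ext
    rw [← hxr r, ← hxr r', h]
  calc Nat.card RB = Nat.card g'.ker * Nat.card g'.range := hcard
    _ ≤ (Nat.card (datumStrictSelmer H A p (AcSelmer.bdpData A p 𝔭) S₀) *
          Nat.card {x : C // ∀ g : ↥(H ⊓ decomp 𝔭), g • x = x} ^ (p ^ c)) *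
          Nat.card (datumStrictSelmer H C p (AcSelmer.bdpData C p 𝔭) S₀) := by
        refine Nat.mul_le_mul (hker_le.trans (hYle.trans ?_)) hrange_le
        exact Nat.mul_le_mul_left _ (Nat.pow_le_pow_left hTle _)
    _ = _ := by ring

/-- **Upper count at a NON-ANOMALOUS `𝔭`: `#R(B) ≤ #R(A) · #R(C)`** — if `C` has no non-zero vector fixed by
`H ⊓ D_𝔭 = G_{K_{∞,𝔭}}` (hypothesis (S) of CGLS Prop. 17, `ψ|_{G_p} ≠ 1`; automatic at a non-split multiplicative
Eisenstein prime) the local error disappears. [cite: CastellaGrossiLeeSkinner2022, Prop. 17 and (eq:lambda-imp) (arXiv:2008.02571 §1.4, §3.3)] -/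
theorem natCard_datumStrictSelmer_le_of_devissage_of_noFixed [Finite C]
    (h𝔭 : ((p : ℕ) : 𝓞 K) ∈ 𝔭.asIdeal) (j : A →+ B)
    (hj' : ∀ (σ : absoluteGaloisGroup K) (a : A), j (σ • a) = σ • j a) (hinj : Function.Injective j)
    (q : B →+ C) (hq' : ∀ (σ : absoluteGaloisGroup K) (b : B), q (σ • b) = σ • q b)
    (hqj : ∀ a : A, q (j a) = 0)
    (hsurj : Function.Surjective q) (hexact : ∀ b : B, q b = 0 → ∃ a : A, j a = b)
    (hcontB : ∀ b : B, Continuous fun g : absoluteGaloisGroup K ↦ g • b)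
    (hU : ∀ v : HeightOneSpectrum (𝓞 K), v ∉ S₀ → ((p : ℕ) : 𝓞 K) ∉ v.asIdeal →
      Function.Injective
        (resH1Hom (ContinuousMonoidHom.id (inertiaIn κ.kerSubgroup v)) j (fun _ a ↦ hj' _ a)))
    (c : ℕ) (τ : ℕ → absoluteGaloisGroup K)
    (hreps : ∀ x : Literature.NumberTheory.EllipticCurves.subgroupH1 κ.kerSubgroup A,
      (∀ i, i < p ^ c → resOfLe A (inf_le_left : κ.kerSubgroup ⊓ decomp 𝔭 ≤ κ.kerSubgroup)
        (conjH1 κ.kerSubgroup A (τ i) x) = 0) →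
      ∀ σ : absoluteGaloisGroup K, resOfLe A (inf_le_left : κ.kerSubgroup ⊓ decomp 𝔭 ≤ κ.kerSubgroup)
        (conjH1 κ.kerSubgroup A σ x) = 0)
    (hS𝔭 : ∀ x : C, (∀ g : ↥(κ.kerSubgroup ⊓ decomp 𝔭), g • x = x) → x = 0)
    (hA : (datumStrictSelmer κ.kerSubgroup A p (AcSelmer.bdpData A p 𝔭) S₀ :
      Set (Literature.NumberTheory.EllipticCurves.subgroupH1 κ.kerSubgroup A)).Finite)
    (hC : (datumStrictSelmer κ.kerSubgroup C p (AcSelmer.bdpData C p 𝔭) S₀ :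
      Set (Literature.NumberTheory.EllipticCurves.subgroupH1 κ.kerSubgroup C)).Finite) :
    Nat.card (datumStrictSelmer κ.kerSubgroup B p (AcSelmer.bdpData B p 𝔭) S₀) ≤
      Nat.card (datumStrictSelmer κ.kerSubgroup A p (AcSelmer.bdpData A p 𝔭) S₀) *
        Nat.card (datumStrictSelmer κ.kerSubgroup C p (AcSelmer.bdpData C p 𝔭) S₀) := by
  have h := natCard_datumStrictSelmer_le_of_devissage_fixed κ 𝔭 S₀ h𝔭 j hj' hinj q hq' hqj hsurj hexact hcontB
    hU c τ hreps hA hC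
  haveI : Subsingleton {x : C // ∀ g : ↥(κ.kerSubgroup ⊓ decomp 𝔭), g • x = x} :=
    ⟨fun x y ↦ Subtype.ext ((hS𝔭 x.1 x.2).trans (hS𝔭 y.1 y.2).symm)⟩
  haveI : Nonempty {x : C // ∀ g : ↥(κ.kerSubgroup ⊓ decomp 𝔭), g • x = x} := ⟨⟨0, fun g ↦ smul_zero g⟩⟩
  have h1 : Nat.card {x : C // ∀ g : ↥(κ.kerSubgroup ⊓ decomp 𝔭), g • x = x} = 1 :=
    Nat.card_unique
  rw [h1, one_pow, mul_one] at h
  exact h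

/-! ### §3 LOWER count with the global error at the fixed points of `H` -/

/-- **Lower count, sharp global term: `#R(A) · #R(C) ≤ #R(B) · #C^{H}`** given the surjectivity of
`q_* : R(B) → R(C)` (`C^H` = the `G_{K_∞}`-fixed vectors of `C`; Keller–Yin's `+1` when `ψ|_{G_K} = 1`).
Same proof as file 2 §4 with §1 above at `G = H`.
[cite: KellerYin2024, Thm. 1.4.1 and Rem. 1.4.2 (arXiv:2402.12781v2 §1.4)] [cite: PollackWeston2011, App. A Prop. A.2] -/
theorem natCard_mul_natCard_le_of_surjective_fixed [Finite C] (j : A →+ B)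
    (hj' : ∀ (σ : absoluteGaloisGroup K) (a : A), j (σ • a) = σ • j a) (hinj : Function.Injective j)
    (q : B →+ C) (hq' : ∀ (σ : absoluteGaloisGroup K) (b : B), q (σ • b) = σ • q b)
    (hqj : ∀ a : A, q (j a) = 0) (hexact : ∀ b : B, q b = 0 → ∃ a : A, j a = b)
    (hB : (datumStrictSelmer κ.kerSubgroup B p (AcSelmer.bdpData B p 𝔭) S₀ :
      Set (Literature.NumberTheory.EllipticCurves.subgroupH1 κ.kerSubgroup B)).Finite)
    (hsurjR : ∀ z ∈ datumStrictSelmer κ.kerSubgroup C p (AcSelmer.bdpData C p 𝔭) S₀,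
      ∃ y ∈ datumStrictSelmer κ.kerSubgroup B p (AcSelmer.bdpData B p 𝔭) S₀,
        resH1Hom (ContinuousMonoidHom.id κ.kerSubgroup) q (fun _ b ↦ hq' _ b) y = z) :
    Nat.card (datumStrictSelmer κ.kerSubgroup A p (AcSelmer.bdpData A p 𝔭) S₀) *
        Nat.card (datumStrictSelmer κ.kerSubgroup C p (AcSelmer.bdpData C p 𝔭) S₀) ≤
      Nat.card (datumStrictSelmer κ.kerSubgroup B p (AcSelmer.bdpData B p 𝔭) S₀) *
        Nat.card {x : C // ∀ g : ↥κ.kerSubgroup, g • x = x} := by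
  let H := κ.kerSubgroup
  let jH := resH1Hom (ContinuousMonoidHom.id H) j (fun _ a ↦ hj' _ a)
  let qH := resH1Hom (ContinuousMonoidHom.id H) q (fun _ b ↦ hq' _ b)
  let RA := datumStrictSelmer H A p (AcSelmer.bdpData A p 𝔭) S₀
  let RB := datumStrictSelmer H B p (AcSelmer.bdpData B p 𝔭) S₀
  let RC := datumStrictSelmer H C p (AcSelmer.bdpData C p 𝔭) S₀
  haveI hBfin : Finite RB := hB.to_subtype
  let g' : RB →+ Literature.NumberTheory.EllipticCurves.subgroupH1 H C := qH.comp RB.subtype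
  have hcardB : Nat.card RB = Nat.card g'.ker * Nat.card g'.range :=
    ResidualDevissageCount.natCard_eq_card_ker_mul_card_range g'
  have hrange : g'.range = RC := by
    ext z
    constructor
    · rintro ⟨r, rfl⟩
      exact resH1Hom_id_mem_residualSelmer H p 𝔭 S₀ q hq' (fun _ b ↦ hq' _ b) r.2
    · intro hz
      obtain ⟨y, hy, e⟩ := hsurjR z hz
      exact ⟨⟨y, hy⟩, e⟩
  have hrangeC : Nat.card g'.range = Nat.card RC := by rw [hrange]
  let h : RA →+ Literature.NumberTheory.EllipticCurves.subgroupH1 H B := jH.comp RA.subtype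
  have hcardA : Nat.card RA = Nat.card h.ker * Nat.card h.range :=
    ResidualDevissageCount.natCard_eq_card_ker_mul_card_range h
  haveI : Finite {y : Literature.NumberTheory.EllipticCurves.subgroupH1 H A // jH y = 0} :=
    (finite_ker_resH1Hom_id_of_finite (G := H) j (fun _ a ↦ hj' _ a) hinj q hexact).to_subtype
  have hkerC : Nat.card h.ker ≤ Nat.card {x : C // ∀ g : ↥H, g • x = x} := by
    refine le_trans ?_ (natCard_ker_resH1Hom_id_le_fixedPoints (G := H) j (fun _ a ↦ hj' _ a) hinj q
      (fun _ b ↦ hq' _ b) hqj hexact)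
    refine Nat.card_le_card_of_injective (fun r ↦ (⟨((r : RA) :
      Literature.NumberTheory.EllipticCurves.subgroupH1 H A), (AddMonoidHom.mem_ker).mp r.2⟩ :
        {y : Literature.NumberTheory.EllipticCurves.subgroupH1 H A // jH y = 0})) fun r r' e ↦ ?_
    dsimp only at e
    exact Subtype.ext (Subtype.ext (Subtype.mk.inj e))
  have hrangeB : ∀ z ∈ h.range, z ∈ RB ∧ qH z = 0 := by
    rintro _ ⟨r, rfl⟩
    exact ⟨resH1Hom_id_mem_residualSelmer H p 𝔭 S₀ j hj' (fun _ a ↦ hj' _ a) r.2,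
      resH1Hom_id_comp_eq_zero (G := H) j (fun _ a ↦ hj' _ a) q (fun _ b ↦ hq' _ b) hqj _⟩
  have hrange_le : Nat.card h.range ≤ Nat.card g'.ker := by
    refine Nat.card_le_card_of_injective (fun z ↦ (⟨⟨(z : Literature.NumberTheory.EllipticCurves.subgroupH1 H B),
      (hrangeB _ z.2).1⟩, (AddMonoidHom.mem_ker).mpr (hrangeB _ z.2).2⟩ : g'.ker)) fun z z' e ↦ ?_
    dsimp only at e
    exact Subtype.ext (Subtype.mk.inj (Subtype.mk.inj e))
  calc Nat.card RA * Nat.card RC = Nat.card h.ker * Nat.card h.range * Nat.card RC := by rw [hcardA]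
    _ ≤ Nat.card {x : C // ∀ g : ↥H, g • x = x} * Nat.card g'.ker * Nat.card g'.range := by
        rw [hrangeC]
        exact Nat.mul_le_mul_right _ (Nat.mul_le_mul hkerC hrange_le)
    _ = Nat.card RB * Nat.card {x : C // ∀ g : ↥H, g • x = x} := by rw [hcardB]; ring

/-- **Lower count when `C^{H} = 0` (Keller–Yin's case `ψ|_{G_K} ≠ 1`): `#R(A) · #R(C) ≤ #R(B)`** given the
surjectivity. [cite: KellerYin2024, Thm. 1.4.1 (first display) (arXiv:2402.12781v2 §1.4)] -/
theorem natCard_mul_natCard_le_of_surjective_of_noFixed [Finite C] (j : A →+ B)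
    (hj' : ∀ (σ : absoluteGaloisGroup K) (a : A), j (σ • a) = σ • j a) (hinj : Function.Injective j)
    (q : B →+ C) (hq' : ∀ (σ : absoluteGaloisGroup K) (b : B), q (σ • b) = σ • q b)
    (hqj : ∀ a : A, q (j a) = 0) (hexact : ∀ b : B, q b = 0 → ∃ a : A, j a = b)
    (hB : (datumStrictSelmer κ.kerSubgroup B p (AcSelmer.bdpData B p 𝔭) S₀ :
      Set (Literature.NumberTheory.EllipticCurves.subgroupH1 κ.kerSubgroup B)).Finite)
    (hsurjR : ∀ z ∈ datumStrictSelmer κ.kerSubgroup C p (AcSelmer.bdpData C p 𝔭) S₀,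
      ∃ y ∈ datumStrictSelmer κ.kerSubgroup B p (AcSelmer.bdpData B p 𝔭) S₀,
        resH1Hom (ContinuousMonoidHom.id κ.kerSubgroup) q (fun _ b ↦ hq' _ b) y = z)
    (hSK : ∀ x : C, (∀ g : ↥κ.kerSubgroup, g • x = x) → x = 0) :
    Nat.card (datumStrictSelmer κ.kerSubgroup A p (AcSelmer.bdpData A p 𝔭) S₀) *
        Nat.card (datumStrictSelmer κ.kerSubgroup C p (AcSelmer.bdpData C p 𝔭) S₀) ≤
      Nat.card (datumStrictSelmer κ.kerSubgroup B p (AcSelmer.bdpData B p 𝔭) S₀) := by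
  have h := natCard_mul_natCard_le_of_surjective_fixed κ 𝔭 S₀ j hj' hinj q hq' hqj hexact hB hsurjR
  haveI : Subsingleton {x : C // ∀ g : ↥κ.kerSubgroup, g • x = x} :=
    ⟨fun x y ↦ Subtype.ext ((hSK x.1 x.2).trans (hSK y.1 y.2).symm)⟩
  haveI : Nonempty {x : C // ∀ g : ↥κ.kerSubgroup, g • x = x} := ⟨⟨0, fun g ↦ smul_zero g⟩⟩
  have h1 : Nat.card {x : C // ∀ g : ↥κ.kerSubgroup, g • x = x} = 1 := Nat.card_unique
  rw [h1, mul_one] at h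
  exact h

end Residual

end Summit.BirchSwinnertonDyer.BirchSwinnertonDyer.Theorems.ResidualDevissageCountSharp

end
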